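import Summits.CriticalPhenomena.PercolationContinuityZ3.Theorems.SahiMasterFamilyPhiProduct
import Summits.CriticalPhenomena.PercolationContinuityZ3.Theorems.SahiMasterFamilyPhiSegment
import Summits.CriticalPhenomena.PercolationContinuityZ3.Theorems.SahiMasterFamilyPhiScale

/-!
# `F(n)` holds at every MIN-CLOSED point, every order: `Φ_n(β) ≥ 0` whenever `β : 2^{[n]} → [0,1]` satisfies
# `β(S ∪ T) ≥ min(β S, β T)` — vertices, vertex rays, segments, chains of union-closed families, Lieb–Sahi's chain lemma

Unit `prim-masterthm-p4` (gen 14; crux anchor stmt-CriticalPhenomena-4575, helper work; memo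
`run/shared/lean/prim/prim-masterthm/prim-masterthm-p4/P4-GEN14-REPORT.md` §4).  Assembly of `…PhiVertex` ((V)), `…PhiScale`
(scaling), `…PhiSegment` (segments `1_𝒰 + w·1_{𝒰ᶜ}`) and `…PhiProduct` (pointwise products via the law of total cumulance).

A set function `β` with values in `[0,1]` is MIN-CLOSED if `β(S ∪ T) ≥ min(β S, β T)` for all `S, T` (then it is supermultiplicative,
`β S·β T ≤ min ≤ β(S∪T)`; its upper level sets `{β ≥ u}` are a CHAIN of union-closed families and `β_S = P(S ∈ 𝒢(U))` for the monotone
family `𝒢(u) = {β ≥ u}`, `U` uniform — "a G-system over a chain", memo §2).  Examples: the vertices `1_𝒰`; the rays `v·1_𝒰`; the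
segments `1_𝒰 + w·1_{𝒰ᶜ}`; all finite chains `Σ_j q_j 1_{𝒰_j}`; the pure chains `β_S = min_{i∈S} β_i` of Lieb–Sahi's Lemma 3.2 /
Blinovsky's chain lemma.

**THEOREM (every order)** `phiSet_nonneg_of_minClosed`: every min-closed `β : Finset (Fin (n+1)) → [0,1]` has `Φ_{n+1}(β) ≥ 0`
(no top condition; in particular `PhiNonneg (n+1)` holds at every min-closed point of its feasible set, `phiNonneg_minClosed`).
PROOF: induction on `#{S : 0 < β S < 1}`.  If the maximum `M` of `β` is `< 1`, `β = M·(β/M)` and scaling (`…PhiScale`) applies to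
`β/M`, which has fewer fractional values; if `M = 1`, the top level `𝒰₁ = {β = 1}` is union-closed and, with `m₂` the largest value
below `1`, `β = (1_{𝒰₁} + m₂·1_{𝒰₁ᶜ}) · min(1, β/m₂)` is the product of a SEGMENT point (quotient-positive, `…PhiSegment` +
`phiSet_segment_quotient_nonneg`) and a min-closed function with fewer fractional values (`…PhiProduct`); the base is (V) / the vanishing
lemma.  HONEST FRAMING: `F(n)` on an explicit full-dimensional-in-no-direction but infinite family of feasible points for EVERY `n`;
`PhiNonneg n` itself (n ≥ 8), Sahi's `C_k`, Kahn's Conjecture 5 and the master theorem remain OPEN.  Axioms standard. [this work]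
-/

noncomputable section

open scoped Classical

namespace Summit.CriticalPhenomena.PercolationContinuityZ3.Theorems

namespace PhiMinClosed

open Finset Function
open Literature.Combinatorics.Sahi2008
open PrincipalCapBeta (phiSet)

variable {n : ℕ}

/-! ### Segment points are quotient-positive -/

/-- `Φ_L ≥ 0` for segment points at every arity `L` (including the trivial `L = 0`). [this work] -/
theorem phiSet_segment_nonneg' : ∀ (L : ℕ) (𝒰 : Finset (Finset (Fin L))), (∀ A ∈ 𝒰, ∀ B ∈ 𝒰, A ∪ B ∈ 𝒰) →
    ∀ {w : ℝ}, 0 ≤ w → w ≤ 1 → 0 ≤ phiSet L (fun S => if S ∈ 𝒰 then (1 : ℝ) else w)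
  | 0, _, _, _, _, _ => PhiProduct.phiSet_zero_nonneg _
  | L + 1, 𝒰, hU, _, hw0, hw1 => PhiSegment.phiSet_segment_nonneg L 𝒰 hU hw0 hw1

/-- **Quotients of segment points are segment points**, so segment points are quotient-positive: for any blocks `B_m`,
`0 ≤ Φ_L(Q ↦ c(⋃_{m∈Q} B_m))` for `c = 1_𝒰 + w·1_{𝒰ᶜ}`. [this work] -/
theorem phiSet_segment_quotient_nonneg {N : ℕ} (𝒰 : Finset (Finset (Fin N))) (hU : ∀ A ∈ 𝒰, ∀ B ∈ 𝒰, A ∪ B ∈ 𝒰)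
    {w : ℝ} (hw0 : 0 ≤ w) (hw1 : w ≤ 1) (L : ℕ) (B : Fin L → Finset (Fin N)) :
    0 ≤ phiSet L (fun Q => if Q.biUnion B ∈ 𝒰 then (1 : ℝ) else w) := by
  have e1 : (fun Q : Finset (Fin L) => if Q.biUnion B ∈ 𝒰 then (1 : ℝ) else w) =
      fun Q => if Q ∈ (univ : Finset (Finset (Fin L))).filter (fun Q => Q.biUnion B ∈ 𝒰) then (1 : ℝ) else w := by
    funext Q; simp only [mem_filter, mem_univ, true_and]
  rw [e1]
  refine phiSet_segment_nonneg' L _ (fun A hA A' hA' => ?_) hw0 hw1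
  rw [mem_filter] at hA hA' ⊢
  refine ⟨mem_univ _, ?_⟩
  rw [Finset.union_biUnion]
  exact hU _ hA.2 _ hA'.2

/-- **Product with a segment point**: if every restriction of `a` is Sahi-nonnegative then `Φ_{n+1}(S ↦ a S · c S) ≥ 0` for the
segment point `c = 1_𝒰 + w·1_{𝒰ᶜ}` of any union-closed `𝒰`. [this work] -/
theorem phiSet_mul_segment_nonneg (a : Finset (Fin (n + 1)) → ℝ)
    (ha : ∀ (L : ℕ) (e : Fin L ↪ Fin (n + 1)), 0 ≤ phiSet L (fun S => a (S.map e)))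
    (𝒰 : Finset (Finset (Fin (n + 1)))) (hU : ∀ A ∈ 𝒰, ∀ B ∈ 𝒰, A ∪ B ∈ 𝒰) {w : ℝ} (hw0 : 0 ≤ w) (hw1 : w ≤ 1) :
    0 ≤ phiSet (n + 1) (fun S => a S * (if S ∈ 𝒰 then (1 : ℝ) else w)) :=
  PhiProduct.phiSet_mul_nonneg a _ ha fun L B _ => phiSet_segment_quotient_nonneg 𝒰 hU hw0 hw1 L B

/-! ### Min-closed set functions -/

/-- The number of FRACTIONAL values (strictly between `0` and `1`), the induction measure. [this work] -/
theorem card_frac_map_le {m : ℕ} (β : Finset (Fin n) → ℝ) (e : Fin m ↪ Fin n) :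
    ((univ : Finset (Finset (Fin m))).filter (fun S => 0 < β (S.map e) ∧ β (S.map e) < 1)).card ≤
      ((univ : Finset (Finset (Fin n))).filter (fun S => 0 < β S ∧ β S < 1)).card := by
  refine Finset.card_le_card_of_injOn (fun S => S.map e) (fun S hS => ?_) (fun S _ T _ h => Finset.map_injective e h)
  rw [mem_coe, mem_filter] at hS ⊢
  exact ⟨mem_univ _, hS.2⟩

/-- Restrictions of min-closed functions are min-closed. [this work] -/
theorem minClosed_map {m : ℕ} (β : Finset (Fin n) → ℝ) (hmin : ∀ S T, min (β S) (β T) ≤ β (S ∪ T)) (e : Fin m ↪ Fin n)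
    (S T : Finset (Fin m)) : min (β (S.map e)) (β (T.map e)) ≤ β ((S ∪ T).map e) := by
  rw [Finset.map_union]; exact hmin _ _

/-- **`F` at every min-closed point, every order** — induction on the number of fractional values. [this work] -/
theorem phiSet_nonneg_of_minClosed_aux : ∀ (N n : ℕ) (β : Finset (Fin (n + 1)) → ℝ), (∀ B, 0 ≤ β B) → (∀ B, β B ≤ 1) →
    (∀ S T, min (β S) (β T) ≤ β (S ∪ T)) →
    ((univ : Finset (Finset (Fin (n + 1)))).filter (fun S => 0 < β S ∧ β S < 1)).card ≤ N → 0 ≤ phiSet (n + 1) β := by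
  intro N
  induction N with
  | zero =>
    intro n β h0 h1 hmin hE
    -- no fractional values: a vertex (or the zero function)
    have h01 : ∀ B, β B = 0 ∨ β B = 1 := fun B => by
      by_contra h
      push Not at h
      have hB : B ∈ (univ : Finset (Finset (Fin (n + 1)))).filter (fun S => 0 < β S ∧ β S < 1) :=
        mem_filter.2 ⟨mem_univ _, lt_of_le_of_ne (h0 B) (Ne.symm h.1), lt_of_le_of_ne (h1 B) h.2⟩
      have : 0 < ((univ : Finset (Finset (Fin (n + 1)))).filter (fun S => 0 < β S ∧ β S < 1)).card := card_pos.2 ⟨B, hB⟩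
      omega
    have hsup : ∀ S T, β S * β T ≤ β (S ∪ T) := fun S T =>
      le_trans (by rcases h01 S with h | h <;> rcases h01 T with h' | h' <;> simp [h, h']) (hmin S T)
    have h := PhiScale.phiSet_map_nonneg_of_zero_one β h01 hsup n (Function.Embedding.refl _)
    simp only [Finset.map_refl] at h
    exact h
  | succ N ih =>
    intro n β h0 h1 hmin hE
    have hsup : ∀ S T, β S * β T ≤ β (S ∪ T) := fun S T => by
      have := hmin S T
      rcases le_total (β S) (β T) with hle | hle
      · rw [min_eq_left hle] at this
        calc β S * β T ≤ β S * 1 := mul_le_mul_of_nonneg_left (h1 T) (h0 S)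
          _ = β S := mul_one _
          _ ≤ β (S ∪ T) := this
      · rw [min_eq_right hle] at this
        calc β S * β T ≤ 1 * β T := mul_le_mul_of_nonneg_right (h1 S) (h0 T)
          _ = β T := one_mul _
          _ ≤ β (S ∪ T) := this
    -- the maximum `M = β S₀`
    obtain ⟨S₀, -, hS₀⟩ := exists_mem_eq_sup' (univ_nonempty (α := Finset (Fin (n + 1)))) β
    have hleM' : ∀ S, β S ≤ β S₀ := fun S => by rw [← hS₀]; exact le_sup' β (mem_univ S)
    set M := β S₀ with hM
    have hleM : ∀ S, β S ≤ M := fun S => by rw [hM]; exact hleM' S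
    have hM0 : 0 ≤ M := by rw [hM]; exact h0 S₀
    have hM1 : M ≤ 1 := by rw [hM]; exact h1 S₀
    by_cases hMz : M = 0
    · -- β ≡ 0
      have hz : ∀ S, β S = 0 := fun S => le_antisymm (hMz ▸ hleM S) (h0 S)
      exact le_of_eq (PhiVertex.phiSet_eq_zero_of_univ_eq_zero β h0 hsup (hz univ)).symm
    have hMpos : 0 < M := lt_of_le_of_ne hM0 (Ne.symm hMz)
    rcases lt_or_eq_of_le hM1 with hMlt | hMeq
    · -- Case `M < 1`: scale.  `β = M·β°`, `β° = β/M` has max `1` and fewer fractional values.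
      let β' : Finset (Fin (n + 1)) → ℝ := fun S => β S / M
      have h0' : ∀ B, 0 ≤ β' B := fun B => div_nonneg (h0 B) hM0
      have h1' : ∀ B, β' B ≤ 1 := fun B => (div_le_one hMpos).2 (hleM B)
      have hmin' : ∀ S T, min (β' S) (β' T) ≤ β' (S ∪ T) := fun S T => by
        show min (β S / M) (β T / M) ≤ β (S ∪ T) / M
        rw [min_div_div_right (le_of_lt hMpos)]
        exact div_le_div_of_nonneg_right (hmin S T) hM0
      -- fractional values of β' (and of its restrictions) are fractional values of β other than the top level
      have hE' : ∀ (k : ℕ) (e : Fin (k + 1) ↪ Fin (n + 1)),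
          ((univ : Finset (Finset (Fin (k + 1)))).filter (fun S => 0 < β' (S.map e) ∧ β' (S.map e) < 1)).card ≤ N := by
        intro k e
        refine le_trans (card_frac_map_le β' e) ?_
        have hsub : (univ : Finset (Finset (Fin (n + 1)))).filter (fun S => 0 < β' S ∧ β' S < 1) ⊆
            ((univ : Finset (Finset (Fin (n + 1)))).filter (fun S => 0 < β S ∧ β S < 1)).erase S₀ := by
          intro S hS
          rw [mem_filter] at hS
          rw [mem_erase, mem_filter]
          have hlt : β S < M := by
            have := hS.2.2
            show β S < M
            by_contra hge
            push Not at hge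
            have : β S / M = 1 := by rw [le_antisymm (hleM S) hge, div_self hMz]
            exact absurd this (ne_of_lt hS.2.2)
          refine ⟨fun h => ?_, mem_univ _, ?_, hlt.trans hMlt⟩
          · rw [h, ← hM] at hlt; exact lt_irrefl _ hlt
          · have := hS.2.1
            exact (div_pos_iff_of_pos_right hMpos).1 this
        have hS₀mem : S₀ ∈ (univ : Finset (Finset (Fin (n + 1)))).filter (fun S => 0 < β S ∧ β S < 1) :=
          mem_filter.2 ⟨mem_univ _, by rw [← hM]; exact hMpos, by rw [← hM]; exact hMlt⟩
        have := card_le_card hsub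
        rw [card_erase_of_mem hS₀mem] at this
        omega
      have hher : ∀ (k : ℕ) (e : Fin (k + 1) ↪ Fin (n + 1)), 0 ≤ phiSet (k + 1) (fun S => β' (S.map e)) :=
        fun k e => ih k (fun S => β' (S.map e)) (fun B => h0' _) (fun B => h1' _) (minClosed_map β' hmin' e) (hE' k e)
      have key := PhiScale.phiSet_smul_nonneg_of_subfamilies β' hher hM0 hM1
      have hfun : (fun S => M * β' S) = β := funext fun S => by show M * (β S / M) = β S; field_simp
      rwa [hfun] at key
    · -- Case `M = 1`: the top level `𝒰₁ = {β = 1}` is union-closed; peel it off as a segment factor.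
      let 𝒰₁ : Finset (Finset (Fin (n + 1))) := univ.filter fun S => β S = 1
      have hU₁ : ∀ A ∈ 𝒰₁, ∀ B ∈ 𝒰₁, A ∪ B ∈ 𝒰₁ := by
        intro A hA B hB
        rw [mem_filter] at hA hB ⊢
        refine ⟨mem_univ _, le_antisymm (h1 _) ?_⟩
        have := hmin A B
        rw [hA.2, hB.2, min_self] at this
        exact this
      -- the fractional part
      let F : Finset (Finset (Fin (n + 1))) := univ.filter fun S => 0 < β S ∧ β S < 1
      by_cases hF : F = ∅
      · -- no fractional values: base case
        exact ih n β h0 h1 hmin (by rw [show univ.filter (fun S => 0 < β S ∧ β S < 1) = F from rfl, hF, card_empty]; exact Nat.zero_le _)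
      · have hFne : F.Nonempty := nonempty_iff_ne_empty.2 hF
        obtain ⟨S₂, hS₂F, hS₂⟩ := exists_mem_eq_sup' hFne β
        have hS₂' := (mem_filter.1 hS₂F).2
        have hle_m₂' : ∀ S, β S < 1 → β S ≤ β S₂ := by
          intro S hS
          rcases eq_or_lt_of_le (h0 S) with hz | hpos
          · rw [← hz]; exact le_of_lt hS₂'.1
          · rw [← hS₂]; exact le_sup' β (mem_filter.2 ⟨mem_univ _, hpos, hS⟩)
        set m₂ := β S₂ with hm₂
        have hm₂pos : 0 < m₂ := by rw [hm₂]; exact hS₂'.1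
        have hm₂lt : m₂ < 1 := by rw [hm₂]; exact hS₂'.2
        -- every value below 1 is ≤ m₂
        have hle_m₂ : ∀ S, β S < 1 → β S ≤ m₂ := fun S hS => by rw [hm₂]; exact hle_m₂' S hS
        -- the peeled function β'' = min(1, β/m₂)
        let β'' : Finset (Fin (n + 1)) → ℝ := fun S => min 1 (β S / m₂)
        have h0'' : ∀ B, 0 ≤ β'' B := fun B => le_min zero_le_one (div_nonneg (h0 B) (le_of_lt hm₂pos))
        have h1'' : ∀ B, β'' B ≤ 1 := fun B => min_le_left _ _
        have hmin'' : ∀ S T, min (β'' S) (β'' T) ≤ β'' (S ∪ T) := by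
          intro S T
          show min (min 1 (β S / m₂)) (min 1 (β T / m₂)) ≤ min 1 (β (S ∪ T) / m₂)
          have hmono : min (β S / m₂) (β T / m₂) ≤ β (S ∪ T) / m₂ := by
            rw [min_div_div_right (le_of_lt hm₂pos)]
            exact div_le_div_of_nonneg_right (hmin S T) (le_of_lt hm₂pos)
          rw [min_min_min_comm, min_self]
          exact min_le_min le_rfl hmono
        -- factorisation β = β'' · c, c = segment point of 𝒰₁ with w = m₂
        have hfac : β = fun S => β'' S * (if S ∈ 𝒰₁ then (1 : ℝ) else m₂) := by
          funext S
          show β S = min 1 (β S / m₂) * (if S ∈ 𝒰₁ then (1 : ℝ) else m₂)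
          by_cases hS : β S = 1
          · have hmem : S ∈ 𝒰₁ := mem_filter.2 ⟨mem_univ _, hS⟩
            rw [if_pos hmem, hS, mul_one, min_eq_left ((one_le_div hm₂pos).2 (le_of_lt hm₂lt))]
          · have hmem : S ∉ 𝒰₁ := fun h => hS (mem_filter.1 h).2
            have hlt : β S < 1 := lt_of_le_of_ne (h1 S) hS
            rw [if_neg hmem, min_eq_right ((div_le_one hm₂pos).2 (hle_m₂ S hlt)), div_mul_cancel₀ _ (ne_of_gt hm₂pos)]
        -- β'' and its restrictions have fewer fractional values: the level `β = m₂` went up to `1`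
        have hE'' : ∀ (L : ℕ) (e : Fin L ↪ Fin (n + 1)),
            ((univ : Finset (Finset (Fin L))).filter (fun S => 0 < β'' (S.map e) ∧ β'' (S.map e) < 1)).card ≤ N := by
          intro L e
          refine le_trans (card_frac_map_le β'' e) ?_
          have hsub : (univ : Finset (Finset (Fin (n + 1)))).filter (fun S => 0 < β'' S ∧ β'' S < 1) ⊆ F.erase S₂ := by
            intro S hS
            rw [mem_filter] at hS
            have hlt1 : β S / m₂ < 1 := by
              rcases min_lt_iff.1 hS.2.2 with h | h
              · exact absurd h (lt_irrefl _)
              · exact h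
            have hβlt : β S < m₂ := (div_lt_one hm₂pos).1 hlt1
            have hβpos : 0 < β S := (div_pos_iff_of_pos_right hm₂pos).1 (lt_min_iff.1 hS.2.1).2
            rw [mem_erase, mem_filter]
            refine ⟨fun h => ?_, mem_univ _, hβpos, hβlt.trans hm₂lt⟩
            rw [h, ← hm₂] at hβlt; exact lt_irrefl _ hβlt
          have := card_le_card hsub
          rw [card_erase_of_mem hS₂F] at this
          have hFN : F.card ≤ N + 1 := hE
          omega
        have hher : ∀ (L : ℕ) (e : Fin L ↪ Fin (n + 1)), 0 ≤ phiSet L (fun S => β'' (S.map e)) := by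
          intro L e
          cases L with
          | zero => exact PhiProduct.phiSet_zero_nonneg _
          | succ l => exact ih l (fun S => β'' (S.map e)) (fun B => h0'' _) (fun B => h1'' _) (minClosed_map β'' hmin'' e) (hE'' _ e)
        rw [hfac]
        exact phiSet_mul_segment_nonneg β'' hher 𝒰₁ hU₁ (le_of_lt hm₂pos) (le_of_lt hm₂lt)

/-- **THEOREM: `Φ_{n+1}(β) ≥ 0` for every min-closed `β : Finset (Fin (n+1)) → [0,1]`, every order.** [this work] -/
theorem phiSet_nonneg_of_minClosed (β : Finset (Fin (n + 1)) → ℝ) (h0 : ∀ B, 0 ≤ β B) (h1 : ∀ B, β B ≤ 1)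
    (hmin : ∀ S T, min (β S) (β T) ≤ β (S ∪ T)) : 0 ≤ phiSet (n + 1) β :=
  phiSet_nonneg_of_minClosed_aux _ n β h0 h1 hmin le_rfl

/-- **`PhiNonneg n` at every min-closed point of its feasible set** (values in `[0,1]`, `β univ = 1`; min-closedness implies the
supermultiplicativity constraint), every `n ≥ 1`. [this work] -/
theorem phiNonneg_minClosed {m : ℕ} (hm : 1 ≤ m) (β : Finset (Fin m) → ℝ) (h0 : ∀ B, 0 ≤ β B) (h1 : ∀ B, β B ≤ 1)
    (hmin : ∀ S T, min (β S) (β T) ≤ β (S ∪ T)) : 0 ≤ phiSet m β := by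
  obtain ⟨n, rfl⟩ := Nat.exists_eq_add_of_le' hm
  exact phiSet_nonneg_of_minClosed β h0 h1 hmin

/-- **Pure chains** (Lieb–Sahi's Lemma 3.2 / Blinovsky's chain lemma in `Φ`-form): `β_S = min_{i∈S} b_i` with `b_i ∈ [0,1]` — the
normalised moments of NESTED events — is min-closed, so `Φ_{n+1}(β) ≥ 0`. [this work] -/
theorem phiSet_nonneg_of_nested (b : Fin (n + 1) → ℝ) (hb0 : ∀ i, 0 ≤ b i) (hb1 : ∀ i, b i ≤ 1) :
    0 ≤ phiSet (n + 1) (fun S => if h : S.Nonempty then S.inf' h b else 1) := by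
  refine phiSet_nonneg_of_minClosed _ (fun B => ?_) (fun B => ?_) (fun S T => ?_)
  · by_cases h : B.Nonempty
    · rw [dif_pos h]; obtain ⟨i, hi⟩ := h; exact (Finset.le_inf' _ _ fun j _ => hb0 j)
    · rw [dif_neg h]; exact zero_le_one
  · by_cases h : B.Nonempty
    · rw [dif_pos h]; obtain ⟨i, hi⟩ := id h; exact (Finset.inf'_le _ hi).trans (hb1 i)
    · rw [dif_neg h]
  · by_cases hS : S.Nonempty
    · by_cases hT : T.Nonempty
      · have hST : (S ∪ T).Nonempty := hS.mono subset_union_left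
        rw [dif_pos hS, dif_pos hT, dif_pos hST]
        refine Finset.le_inf' _ _ fun i hi => ?_
        rcases mem_union.1 hi with h | h
        · exact (min_le_left _ _).trans (Finset.inf'_le _ h)
        · exact (min_le_right _ _).trans (Finset.inf'_le _ h)
      · rw [not_nonempty_iff_eq_empty.1 hT, union_empty, dif_pos hS]
        exact min_le_left _ _
    · rw [not_nonempty_iff_eq_empty.1 hS, empty_union]
      exact min_le_right _ _

end PhiMinClosed

end Summit.CriticalPhenomena.PercolationContinuityZ3.Theorems
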